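import Literature.Topology.FourManifolds.SlideReshapeUpper2
import Literature.Topology.FourManifolds.RebuildUpperArchFormulas
import Literature.Topology.FourManifolds.K2Lite
import HarnessLib

/-!
# The band-coordinate upper track instantiated on a band core (mirror of `K2LiteBand.lean`)

Topic `Literature/Topology/FourManifolds`; fact seat `provefact-IsStrictHandleSlide.isSurgery`
(R. C. Kirby, *The Topology of 4-Manifolds*, LNM 1374 (1989), Ch. I §4; remaining content: the
named fact (S) `Literature.Topology.FourManifolds.FramedLink.IsStrictHandleSlide.slideModel`).
The upper arch of the rebuilt attaching circle, read in the reversed parameter `τ = -t` and with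
heights reflected in `1/2`, is a lower arch: abscissa `smoothStep (-ahi + epsHi) (-thi - epsHi) τ`,
edge heights `1 - fUp (-τ)` (increasing) and `1 - gUp (-τ)` (decreasing). So the abstract track
data `K2LiteData` (`K2Lite.lean`) instantiated on these (`BandCore.k2liteUp`) give the upper track
`X₁ᵘ t = X₁ (-t)`, `H₁ᵘ t = 1 - H₁ (-t)`, and the hypotheses of
`BandCore.exists_ambientIsotopy_upperTrack'` (`SlideReshapeUpper2.lean`) follow from the abstract
track lemmas by reflection:

* `BandCore.k2liteUp`, `BandCore.exists_ambientIsotopy_k2liteUp` — **the reshaping isotopy of the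
  upper arch along the band-coordinate track**.

## References

* R. C. Kirby, *The Topology of 4-Manifolds*, LNM 1374, Springer (1989), Ch. I §4. [Kirby1989]
-/

open scoped Manifold ContDiff Topology
open Set Real Filter Function

noncomputable section

namespace Literature.Topology.FourManifolds

namespace BandCore

variable {A B : Knot} {avoid : Set (Metric.sphere (0 : EuclideanSpace ℝ (Fin 4)) 1)} (c : BandCore A B avoid)

/-! ### The reflected edge heights -/

/-- The reflected `A`-side height of the upper arch, `τ ↦ 1 - fUp (-τ)`. [folklore] -/
def fUpR (τ : ℝ) : ℝ := 1 - c.fUp (-τ)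

/-- The reflected `B`-side height of the upper arch, `τ ↦ 1 - gUp (-τ)`. [folklore] -/
def gUpR (τ : ℝ) : ℝ := 1 - c.gUp (-τ)

/-- `fUpR_def` (auxiliary). [folklore] -/
theorem fUpR_def (τ : ℝ) : c.fUpR τ = 1 - c.fUp (-τ) := rfl
/-- `gUpR_def` (auxiliary). [folklore] -/
theorem gUpR_def (τ : ℝ) : c.gUpR τ = 1 - c.gUp (-τ) := rfl

/-- `contDiff_fUpR` (auxiliary). [folklore] -/
theorem contDiff_fUpR : ContDiff ℝ ∞ c.fUpR := contDiff_const.sub (c.fUp_spec.1.comp contDiff_neg)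
/-- `contDiff_gUpR` (auxiliary). [folklore] -/
theorem contDiff_gUpR : ContDiff ℝ ∞ c.gUpR := contDiff_const.sub (c.gUp_spec.1.comp contDiff_neg)

/-- `deriv_fUpR` (auxiliary). [folklore] -/
theorem deriv_fUpR (τ : ℝ) : deriv c.fUpR τ = deriv c.fUp (-τ) := by
  have h : c.fUpR = fun τ ↦ 1 - (fun v ↦ c.fUp (-v)) τ := rfl
  rw [h, deriv_const_sub, deriv_comp_neg, neg_neg]

/-- `deriv_gUpR` (auxiliary). [folklore] -/
theorem deriv_gUpR (τ : ℝ) : deriv c.gUpR τ = deriv c.gUp (-τ) := by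
  have h : c.gUpR = fun τ ↦ 1 - (fun v ↦ c.gUp (-v)) τ := rfl
  rw [h, deriv_const_sub, deriv_comp_neg, neg_neg]

/-- `deriv_fUpR_pos` (auxiliary). [folklore] -/
theorem deriv_fUpR_pos {τ : ℝ} (hτ : τ ≤ -c.thi) : 0 < deriv c.fUpR τ := by
  rw [c.deriv_fUpR]
  have hm := c.marks_lt
  exact c.fUp_spec.2.2.1 (-τ) (by linarith)

/-- `fUpR` is strictly increasing on `(-∞, -thi]`. [folklore] -/
theorem strictMonoOn_fUpR : StrictMonoOn c.fUpR (Iic (-c.thi)) :=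
  strictMonoOn_of_deriv_pos (convex_Iic _) c.contDiff_fUpR.continuous.continuousOn fun x hx ↦
    c.deriv_fUpR_pos (by rw [interior_Iic] at hx; exact le_of_lt hx)

/-- `fUpR_lt_fUpR` (auxiliary). [folklore] -/
theorem fUpR_lt_fUpR {s t : ℝ} (hst : s < t) (ht : t ≤ -c.thi) : c.fUpR s < c.fUpR t :=
  c.strictMonoOn_fUpR (show s ∈ Iic _ by simp only [mem_Iic]; linarith) (show t ∈ Iic _ from ht) hst

/-- `fUpR_le_fUpR` (auxiliary). [folklore] -/
theorem fUpR_le_fUpR {s t : ℝ} (hst : s ≤ t) (ht : t ≤ -c.thi) : c.fUpR s ≤ c.fUpR t := by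
  rcases hst.eq_or_lt with h | h
  · rw [h]
  · exact (c.fUpR_lt_fUpR h ht).le

/-! ### Height facts on the upper landing window -/

/-- On `[thi, ahi]`, `fUp ∈ [7/10, 4/5]`. [folklore] -/
theorem fUp_mem_landing {t : ℝ} (ht : t ∈ Icc c.thi c.ahi) : c.fUp t ∈ Icc (7 / 10 : ℝ) (4 / 5) := by
  have hm := c.marks_lt
  have hmono := c.strictMonoOn_fUp.monotoneOn
  have ha : c.fUp c.ahi = 4 / 5 := by
    rw [(c.fUp_eq_heightA ⟨hm.2.2.2.2.1.le, hm.2.2.2.2.2.1.le⟩).1, c.heightA_marks.2.2.2]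
  have hb : c.fUp c.thi = 7 / 10 := by
    rw [(c.fUp_eq_heightA ⟨le_rfl, by linarith⟩).1, c.heightA_marks.2.2.1]
  constructor
  · rw [← hb]; exact hmono (show c.thi ∈ Ici _ by simp only [mem_Ici]; linarith)
      (show t ∈ Ici _ by simp only [mem_Ici]; linarith [ht.1]) ht.1
  · rw [← ha]; exact hmono (show t ∈ Ici _ by simp only [mem_Ici]; linarith [ht.1])
      (show c.ahi ∈ Ici _ by simp only [mem_Ici]; linarith) ht.2

/-- On `[-ahi, -thi]`, `fUpR ∈ [1/5, 3/10]`. [folklore] -/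
theorem fUpR_mem_window {τ : ℝ} (hτ : τ ∈ Icc (-c.ahi) (-c.thi)) : c.fUpR τ ∈ Icc (1 / 5 : ℝ) (3 / 10) := by
  have h := c.fUp_mem_landing (t := -τ) ⟨by linarith [hτ.2], by linarith [hτ.1]⟩
  rw [fUpR]; exact ⟨by linarith [h.2], by linarith [h.1]⟩

/-- On `[thi, thi + 2 epsHi]`, `7/10 ≤ gUp`. [folklore] -/
theorem gUp_ge_landing {t : ℝ} (ht : t ∈ Icc c.thi (c.thi + 2 * c.epsHi)) : 7 / 10 ≤ c.gUp t := by
  obtain ⟨hε, hε1, hε2⟩ := c.epsHi_bounds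
  obtain ⟨h0, h0'⟩ := c.thi_marksB
  have hl := c.lam_pos
  have h1 : c.gUp (c.thi + 2 * c.epsHi) ≤ c.gUp t :=
    c.strictAntiOn_gUp.antitoneOn (show t ∈ Iic _ by simp only [mem_Iic]; linarith [ht.2])
      (show c.thi + 2 * c.epsHi ∈ Iic _ from h0') ht.2
  have h2 : c.gUp (c.thi + 2 * c.epsHi) = c.heightB (c.psi (c.thi + 2 * c.epsHi) - 1) :=
    c.gUp_spec.2.1 _ ⟨by linarith, h0'⟩
  have hpsi : c.psi (c.thi + 2 * c.epsHi) - 1 = c.thetaB (4 / 5) + 2 * c.epsHi * c.lam := by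
    have := c.psi_sub_psi c.thi (c.thi + 2 * c.epsHi)
    rw [c.psi_thi] at this
    linarith
  have h45 : c.thetaB (9 / 10) ≤ c.thetaB (4 / 5) := c.strictAntiOn_thetaB.antitoneOn (by norm_num) (by norm_num) (by norm_num)
  have h710 : c.thetaB (7 / 10) ≤ c.thetaB 10⁻¹ := c.strictAntiOn_thetaB.antitoneOn (by norm_num) (by norm_num) (by norm_num)
  have h3 : c.heightB (c.thetaB (7 / 10)) ≤ c.heightB (c.psi (c.thi + 2 * c.epsHi) - 1) := by
    apply c.strictAntiOn_heightB.antitoneOn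
    · rw [hpsi]; exact ⟨by nlinarith, by linarith⟩
    · exact ⟨(c.strictAntiOn_thetaB (by norm_num) (by norm_num) (by norm_num : (7 / 10 : ℝ) < 9 / 10)).le, h710⟩
    · rw [hpsi]; linarith
  rw [c.heightB_thetaB (by norm_num)] at h3
  linarith

/-- On the reflected landing window `[-thi - 2 epsHi, ∞) ∩ (-∞, -thi]`, `gUpR ≤ 3/10`. [folklore] -/
theorem gUpR_le_landing {τ : ℝ} (hτ : τ ∈ Icc (-c.thi - c.epsHi - c.epsHi) (-c.thi)) : c.gUpR τ ≤ 3 / 10 := by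
  have := c.gUp_ge_landing (t := -τ) ⟨by linarith [hτ.2], by linarith [hτ.1]⟩
  rw [gUpR]; linarith

/-! ### The quantitative constants -/

/-- The virtual height of the reflected upper track (before instantiation). [folklore] -/
def liteHhU (τ : ℝ) : ℝ := c.fUpR τ + 3 / 20 * smoothStep (-c.thi - c.epsHi - c.epsHi) (-c.thi - c.epsHi - c.epsHi / 2) τ

/-- The lower landing level of the reflected upper track. [folklore] -/
def liteHr0U : ℝ := c.fUpR (-c.thi - c.epsHi - c.epsHi / 2) + 13 / 100

/-- The upper landing level of the reflected upper track. [folklore] -/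
def liteHr1U : ℝ := c.fUpR (-c.thi - c.epsHi - c.epsHi / 2) + 14 / 100

/-- `liteHrU_lt` (auxiliary). [folklore] -/
theorem liteHrU_lt : c.liteHr0U < c.liteHr1U := by rw [liteHr0U, liteHr1U]; linarith

/-- `continuous_liteHhU` (auxiliary). [folklore] -/
theorem continuous_liteHhU : Continuous c.liteHhU :=
  c.contDiff_fUpR.continuous.add (continuous_const.mul (continuous_smoothStep _ _))

/-- A bound of `Hh'` on the reflected landing window. [folklore] -/
theorem exists_liteMHU : ∃ M : ℝ, ∀ τ ∈ Icc (-c.thi - c.epsHi - c.epsHi) (-c.thi - c.epsHi + c.epsHi),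
    deriv c.fUpR τ + 3 / 20 * deriv (smoothStep (-c.thi - c.epsHi - c.epsHi) (-c.thi - c.epsHi - c.epsHi / 2)) τ ≤ M := by
  have hc : Continuous (fun τ ↦ deriv c.fUpR τ + 3 / 20 * deriv (smoothStep (-c.thi - c.epsHi - c.epsHi) (-c.thi - c.epsHi - c.epsHi / 2)) τ) :=
    (c.contDiff_fUpR.continuous_deriv (by simp)).add (continuous_const.mul ((contDiff_smoothStep _ _).continuous_deriv (by simp)))
  obtain ⟨M, hM⟩ := (isCompact_Icc.image hc).isBounded.bddAbove
  exact ⟨M, fun t ht ↦ hM (mem_image_of_mem _ ht)⟩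

/-- `liteMHU` (auxiliary). [folklore] -/
def liteMHU : ℝ := Classical.choose c.exists_liteMHU

/-- `liteMHU_spec` (auxiliary). [folklore] -/
theorem liteMHU_spec : ∀ τ ∈ Icc (-c.thi - c.epsHi - c.epsHi) (-c.thi - c.epsHi + c.epsHi),
    deriv c.fUpR τ + 3 / 20 * deriv (smoothStep (-c.thi - c.epsHi - c.epsHi) (-c.thi - c.epsHi - c.epsHi / 2)) τ ≤ c.liteMHU :=
  Classical.choose_spec c.exists_liteMHU

/-- `liteMHU_pos` (auxiliary). [folklore] -/
theorem liteMHU_pos : 0 < c.liteMHU := by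
  have hε := c.epsHi_bounds.1
  have h1 : 0 < deriv c.fUpR (-c.thi) := c.deriv_fUpR_pos le_rfl
  have h2 : 0 ≤ deriv (smoothStep (-c.thi - c.epsHi - c.epsHi) (-c.thi - c.epsHi - c.epsHi / 2)) (-c.thi) :=
    deriv_smoothStep_nonneg (by linarith) _
  have := c.liteMHU_spec (-c.thi) ⟨by linarith, by linarith⟩
  linarith

/-- A positive lower bound of the abscissa speed of the reflected upper track on the landing levels.
[folklore] -/
theorem exists_liteVminU : ∃ v : ℝ, 0 < v ∧ ∀ τ ∈ Icc (-c.thi - c.epsHi - c.epsHi) (-c.thi - c.epsHi - c.epsHi / 2),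
    smoothStep c.liteHr0U c.liteHr1U (c.liteHhU τ) ∈ Icc (8⁻¹ : ℝ) (7 / 8) →
    v ≤ deriv (smoothStep c.liteHr0U c.liteHr1U) (c.liteHhU τ) * deriv c.fUpR τ := by
  have hε := c.epsHi_bounds.1
  set F : ℝ → ℝ := fun t ↦ deriv (smoothStep c.liteHr0U c.liteHr1U) (c.liteHhU t) * deriv c.fUpR t with hF
  have hFc : Continuous F :=
    (((contDiff_smoothStep _ _).continuous_deriv (by simp)).comp c.continuous_liteHhU).mul
      (c.contDiff_fUpR.continuous_deriv (by simp))
  set Z : Set ℝ := {t ∈ Icc (-c.thi - c.epsHi - c.epsHi) (-c.thi - c.epsHi - c.epsHi / 2) |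
    smoothStep c.liteHr0U c.liteHr1U (c.liteHhU t) ∈ Icc (8⁻¹ : ℝ) (7 / 8)} with hZ
  have hZc : IsCompact Z := by
    refine isCompact_Icc.inter_right ?_
    exact isClosed_Icc.preimage ((continuous_smoothStep _ _).comp c.continuous_liteHhU)
  have hFpos : ∀ t ∈ Z, 0 < F t := by
    rintro t ⟨ht, hS⟩
    have hf : 0 < deriv c.fUpR t := c.deriv_fUpR_pos (by linarith [ht.2])
    have hin : c.liteHhU t ∈ Ioo c.liteHr0U c.liteHr1U := by
      constructor
      · by_contra h; rw [smoothStep_of_le c.liteHrU_lt (le_of_not_gt h)] at hS; norm_num at hS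
      · by_contra h; rw [smoothStep_of_ge c.liteHrU_lt (le_of_not_gt h)] at hS; norm_num at hS
    exact mul_pos (deriv_smoothStep_pos c.liteHrU_lt hin) hf
  by_cases hne : Z.Nonempty
  · obtain ⟨t₀, ht₀, hmin⟩ := hZc.exists_isMinOn hne hFc.continuousOn
    exact ⟨F t₀, hFpos t₀ ht₀, fun t ht hS ↦ hmin ⟨ht, hS⟩⟩
  · refine ⟨1, one_pos, fun t ht hS ↦ ?_⟩
    exact absurd ⟨t, ht, hS⟩ hne

/-- `liteVminU` (auxiliary). [folklore] -/
def liteVminU : ℝ := Classical.choose c.exists_liteVminU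

/-- `liteVminU_spec` (auxiliary). [folklore] -/
theorem liteVminU_spec : 0 < c.liteVminU ∧ ∀ τ ∈ Icc (-c.thi - c.epsHi - c.epsHi) (-c.thi - c.epsHi - c.epsHi / 2),
    smoothStep c.liteHr0U c.liteHr1U (c.liteHhU τ) ∈ Icc (8⁻¹ : ℝ) (7 / 8) →
    c.liteVminU ≤ deriv (smoothStep c.liteHr0U c.liteHr1U) (c.liteHhU τ) * deriv c.fUpR τ :=
  Classical.choose_spec c.exists_liteVminU

/-- `liteMsU` (auxiliary). [folklore] -/
def liteMsU : ℝ := 2 * c.liteMHU / c.liteVminU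

/-- `liteMsU_pos` (auxiliary). [folklore] -/
theorem liteMsU_pos : 0 < c.liteMsU := div_pos (by linarith [c.liteMHU_pos]) c.liteVminU_spec.1

/-- `liteMsU_mul` (auxiliary). [folklore] -/
theorem liteMsU_mul : c.liteMsU * c.liteVminU = 2 * c.liteMHU := by
  rw [liteMsU]; field_simp [c.liteVminU_spec.1.ne']

/-- The largest admissible tip depth of the upper track. [folklore] -/
def liteKmaxU : ℝ := min 8⁻¹ (101⁻¹ / c.liteMsU)

/-- `liteKmaxU_pos` (auxiliary). [folklore] -/
theorem liteKmaxU_pos : 0 < c.liteKmaxU := lt_min (by norm_num) (div_pos (by norm_num) c.liteMsU_pos)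
/-- `liteKmaxU_le` (auxiliary). [folklore] -/
theorem liteKmaxU_le : c.liteKmaxU ≤ 8⁻¹ := min_le_left _ _
/-- `liteKmaxU_le'` (auxiliary). [folklore] -/
theorem liteKmaxU_le' : c.liteKmaxU ≤ 101⁻¹ / c.liteMsU := min_le_right _ _

/-! ### The reflected track data of the upper arch -/

/-- **The band-coordinate upper track data** (reflected). [cite: Kirby1989, Ch. I §4] -/
def k2liteUp {κD εℓ u₁ : ℝ} (hκ : 0 < κD) (hκ' : κD ≤ c.liteKmaxU) (hε : 0 < εℓ) (hε' : 4 * εℓ ≤ κD)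
    (hu : 0 < u₁) (hu' : u₁ ≤ κD) : K2LiteData where
  a := -c.ahi + c.epsHi
  b := -c.thi - c.epsHi
  ε := c.epsHi
  f := c.fUpR
  g := c.gUpR
  ch := 3 / 20
  κ₀ := 2⁻¹
  hpl := (c.fUpR (-c.ahi + c.epsHi) + c.fUpR (-c.thi - c.epsHi - c.epsHi)) / 2
  hr0 := c.liteHr0U
  hr1 := c.liteHr1U
  κD := κD
  εℓ := εℓ
  u₁ := u₁
  ms := c.liteMsU
  vmin := c.liteVminU
  MH := c.liteMHU
  ε_pos := c.epsHi_bounds.1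
  hab := by linarith [c.thi_add_lt_ahi_sub]
  f_smooth := c.contDiff_fUpR
  g_smooth := c.contDiff_gUpR
  f_deriv_pos := fun τ hτ ↦ c.deriv_fUpR_pos (by linarith)
  g_deriv_neg := fun τ hτ ↦ by
    rw [c.deriv_gUpR]
    exact c.gUp_spec.2.2.1 (-τ) (by linarith [c.thi_marksB.2])
  ch_pos := by norm_num
  κ₀_pos := by norm_num
  κ₀_le := le_rfl
  hpl_gt := by
    have := c.fUpR_lt_fUpR (show -c.ahi + c.epsHi < -c.thi - c.epsHi - c.epsHi by linarith [c.thi_add_lt_ahi_sub, c.epsHi_bounds.1])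
      (by linarith [c.epsHi_bounds.1])
    linarith
  hpl_le := by
    have h1 := c.fUpR_lt_fUpR (show -c.ahi + c.epsHi < -c.thi - c.epsHi - c.epsHi by linarith [c.thi_add_lt_ahi_sub, c.epsHi_bounds.1])
      (by linarith [c.epsHi_bounds.1])
    have h2 := c.fUpR_le_fUpR (show -c.thi - c.epsHi - c.epsHi ≤ -c.thi - c.epsHi - c.epsHi / 2 by linarith [c.epsHi_bounds.1])
      (by linarith [c.epsHi_bounds.1])
    rw [liteHr0U]; linarith
  hr0_gt := by
    have h2 := c.fUpR_le_fUpR (show -c.thi - c.epsHi - c.epsHi ≤ -c.thi - c.epsHi - c.epsHi / 2 by linarith [c.epsHi_bounds.1])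
      (by linarith [c.epsHi_bounds.1])
    rw [liteHr0U]; linarith
  hr_lt := c.liteHrU_lt
  hr1_le := by rw [liteHr1U]; linarith
  κD_pos := hκ
  κD_le := by linarith [hκ'.trans c.liteKmaxU_le]
  κD_small := by linarith [hκ'.trans c.liteKmaxU_le]
  εℓ_pos := hε
  εℓ_le := hε'
  u₁_pos := hu
  u₁_le := hu'
  ms_pos := c.liteMsU_pos
  vmin_pos := c.liteVminU_spec.1
  vmin_le := fun t ht hS ↦ c.liteVminU_spec.2 t ht (by
    have hk := hκ'.trans c.liteKmaxU_le
    have e : c.liteHhU t = c.fUpR t + 3 / 20 * smoothStep (-c.thi - c.epsHi - c.epsHi) (-c.thi - c.epsHi - c.epsHi / 2) t := rfl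
    rw [e]
    exact ⟨by linarith [hS.1], by linarith [hS.2]⟩)
  MH_ge := c.liteMHU_spec
  ms_large := by rw [c.liteMsU_mul]
  f_lo := fun τ hτ ↦ by
    have := (c.fUpR_mem_window (τ := τ) ⟨by linarith [hτ.1, c.epsHi_bounds.1], by linarith [hτ.2]⟩).1
    linarith
  f_hi := fun τ hτ ↦ by
    have := (c.fUpR_mem_window (τ := τ) ⟨by linarith [hτ.1, c.epsHi_bounds.1], by linarith [hτ.2]⟩).2
    linarith
  g_mem := fun τ hτ ↦ by
    have h := c.gUp_mem (t := -τ) (by linarith [hτ.2, c.thi_marksB.1])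
    show 1 - c.gUp (-τ) ∈ _
    exact ⟨by linarith [h.2], by linarith [h.1]⟩
  gap := fun τ hτ ↦ by
    have hg := c.gUpR_le_landing (τ := τ) ⟨hτ.1, by linarith [hτ.2]⟩
    have hf := (c.fUpR_mem_window (τ := -c.thi - c.epsHi - c.epsHi / 2)
      ⟨by linarith [c.thi_add_lt_ahi_sub, c.epsHi_bounds.1], by linarith [c.epsHi_bounds.1]⟩).1
    have hk : c.liteMsU * κD ≤ 101⁻¹ := by
      have := hκ'.trans c.liteKmaxU_le'
      rw [le_div_iff₀ c.liteMsU_pos] at this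
      linarith
    rw [liteHr0U]; linarith

section

variable {κD εℓ u₁ : ℝ} (hκ : 0 < κD) (hκ' : κD ≤ c.liteKmaxU) (hε : 0 < εℓ) (hε' : 4 * εℓ ≤ κD)
  (hu : 0 < u₁) (hu' : u₁ ≤ κD)

/-- The abscissa of the upper arch is the reflected `smoothStep a b` of the track data. [folklore] -/
theorem cUp_fst_eq (t : ℝ) :
    c.cUp t 0 = smoothStep (c.k2liteUp hκ hκ' hε hε' hu hu').a (c.k2liteUp hκ hκ' hε hε' hu hu').b (-t) := by
  rw [c.cUp_apply_zero']; rfl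

/-- The height of the upper arch is `1 - v (-t)` for the reflected track data. [folklore] -/
theorem cUp_snd_eq_v (t : ℝ) : c.cUp t 1 = 1 - (c.k2liteUp hκ hκ' hε hε' hu hu').v (-t) := by
  rw [c.cUp_apply_one', K2LiteData.v]
  have e1 : (c.k2liteUp hκ hκ' hε hε' hu hu').a + (c.k2liteUp hκ hκ' hε hε' hu hu').ε = -c.ahi + 2 * c.epsHi := by
    show -c.ahi + c.epsHi + c.epsHi = _; ring
  have e2 : (c.k2liteUp hκ hκ' hε hε' hu hu').b - (c.k2liteUp hκ hκ' hε hε' hu hu').ε = -c.thi - 2 * c.epsHi := by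
    show -c.thi - c.epsHi - c.epsHi = _; ring
  rw [e1, e2]
  show _ = 1 - ((1 - smoothStep (-c.ahi + 2 * c.epsHi) (-c.thi - 2 * c.epsHi) (-t)) * (1 - c.fUp (- -t)) +
    smoothStep (-c.ahi + 2 * c.epsHi) (-c.thi - 2 * c.epsHi) (-t) * (1 - c.gUp (- -t)))
  rw [neg_neg]; ring

/-- **The reshaping isotopy of the upper arch along the band-coordinate track.**
[cite: Kirby1989, Ch. I §4] -/
theorem exists_ambientIsotopy_k2liteUp (hAB : Disjoint (range ⇑A) (range ⇑B))
    {O : Set (Metric.sphere (0 : EuclideanSpace ℝ (Fin 4)) 1)} (hO : IsOpen O)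
    (hOsub : ∀ u ∈ Icc (0 : ℝ) 1, ∀ s ∈ Icc (c.thi + c.epsHi / 4) (c.ahi - c.epsHi / 2),
      c.band (pt2 ((1 - u) * c.cUp s 0 + u * (c.k2liteUp hκ hκ' hε hε' hu hu').X₁ (-s))
        ((1 - u) * c.cUp s 1 + u * (1 - (c.k2liteUp hκ hκ' hε hε' hu hu').H₁ (-s)))) ∈ O) :
    ∃ (Θ : AmbientIsotopy (𝓡 3) (Metric.sphere (0 : EuclideanSpace ℝ (Fin 4)) 1)) (k₂ : Knot),
      (∀ t y, y ∉ O → Θ.toFun t y = y) ∧ Θ.toFun 1 ∘ ⇑(c.rebuild hAB) = ⇑k₂ ∧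
      (∀ s ∈ Icc (c.thi + c.epsHi / 4) (c.ahi - c.epsHi / 2),
        k₂ (circlePt s) = c.band (pt2 ((c.k2liteUp hκ hκ' hε hε' hu hu').X₁ (-s))
          (1 - (c.k2liteUp hκ hκ' hε hε' hu hu').H₁ (-s)))) ∧
      (∀ t ∈ Ico c.alo (c.alo + 1), t ∉ Icc (c.thi + c.epsHi / 4) (c.ahi - c.epsHi / 2) →
        k₂ (circlePt t) = c.rebuild hAB (circlePt t)) := by
  set d := c.k2liteUp hκ hκ' hε hε' hu hu' with hd
  have hε0 := c.epsHi_bounds.1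
  have hab := c.thi_add_lt_ahi_sub
  have ha : d.a = -c.ahi + c.epsHi := rfl
  have hb : d.b = -c.thi - c.epsHi := rfl
  have hεd : d.ε = c.epsHi := rfl
  have hf : ∀ τ, d.f τ = 1 - c.fUp (-τ) := fun τ ↦ rfl
  have hg : ∀ τ, d.g τ = 1 - c.gUp (-τ) := fun τ ↦ rfl
  have hI : ∀ {s}, s ∈ Icc (c.thi + c.epsHi / 4) (c.ahi - c.epsHi / 2) →
      -s ∈ Icc (d.a - d.ε / 2) (d.b + 3 * d.ε / 4) := fun hs ↦ by
    rw [ha, hb, hεd]; exact ⟨by linarith [hs.2], by linarith [hs.1]⟩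
  -- the reflected track functions and their derivatives
  set X₁ : ℝ → ℝ := fun t ↦ d.X₁ (-t) with hX₁
  set H₁ : ℝ → ℝ := fun t ↦ 1 - d.H₁ (-t) with hH₁
  have hX₁s : ContDiff ℝ ∞ X₁ := d.contDiff_X₁.comp contDiff_neg
  have hH₁s : ContDiff ℝ ∞ H₁ := contDiff_const.sub (d.contDiff_H₁.comp contDiff_neg)
  have hdX : ∀ t, deriv X₁ t = -deriv d.X₁ (-t) := fun t ↦ by
    simp only [hX₁]; rw [deriv_comp_neg]
  have hdH : ∀ t, deriv H₁ t = deriv d.H₁ (-t) := fun t ↦ by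
    simp only [hH₁]
    rw [deriv_const_sub, show (fun t ↦ d.H₁ (-t)) = fun t ↦ d.H₁ (-t) from rfl, deriv_comp_neg, neg_neg]
  refine c.exists_ambientIsotopy_upperTrack' hAB hX₁s hH₁s ?_ ?_ (fun t ↦ d.X₁_mem_Icc _) ?_ ?_ ?_ ?_ ?_ ?_ ?_ ?_ ?_
    hO hOsub
  · -- hagreeX
    intro t ht
    rcases le_or_gt (c.ahi - c.epsHi) t with h | h
    · simp only [hX₁]; rw [d.X₁_of_le_a (by rw [ha]; linarith), c.cUp_fst_eq_zero_of_ge h]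
    · have h2 : t ≤ c.thi + c.epsHi / 2 := by
        by_contra h2; exact ht ⟨lt_of_not_ge h2, h⟩
      simp only [hX₁]; rw [d.X₁_of_ge (by rw [hb, hεd]; linarith), c.cUp_fst_eq_one_of_le (by linarith)]
  · -- hagreeH
    intro t ht
    rcases le_or_gt (c.ahi - c.epsHi) t with h | h
    · simp only [hH₁]
      rw [d.H₁_of_le_a (by rw [ha]; linarith), hf, neg_neg, c.cUp_snd_eq_fUp_of_ge (by linarith)]; ring
    · have h2 : t ≤ c.thi + c.epsHi / 2 := by
        by_contra h2; exact ht ⟨lt_of_not_ge h2, h⟩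
      simp only [hH₁]
      rw [d.H₁_of_ge (by rw [hb, hεd]; linarith), hg, neg_neg, c.cUp_snd_eq_gUp_of_le (by linarith)]; ring
  · -- hdX₁ ≤ 0
    intro t; rw [hdX]; linarith [d.deriv_X₁_nonneg (-t)]
  · -- hX₁zero
    intro s _ h0
    have := d.le_a_of_X₁_eq_zero h0
    simp only [hH₁]; rw [d.H₁_of_le_a this, hf, neg_neg]; ring
  · -- hX₁lt
    intro t ht
    exact d.X₁_lt_one_of_le (by rw [hb, hεd]; linarith)
  · -- hH₁I
    intro t ht
    have h := d.H₁_mem_Ioo (hI ht)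
    simp only [hH₁]; exact ⟨by linarith [h.2], by linarith [h.1]⟩
  · -- hH₁le
    intro t ht hX
    have h := d.g_le_H₁ (t := -t) (by rw [hb, hεd]; exact ⟨by linarith [ht.2], by linarith [ht.1]⟩) hX
    rw [hg, neg_neg] at h
    simp only [hH₁]; linarith
  · -- hinj₁
    intro s hs t ht h
    have h0 : X₁ s = X₁ t := by simpa using congrArg (fun p : EuclideanSpace ℝ (Fin 2) ↦ p 0) h
    have h1 : H₁ s = H₁ t := by simpa using congrArg (fun p : EuclideanSpace ℝ (Fin 2) ↦ p 1) h
    simp only [hX₁] at h0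
    simp only [hH₁] at h1
    have := d.injOn_track (hI hs) (hI ht) (Prod.ext h0 (by linarith))
    linarith
  · -- hreg₁
    intro s hs hX
    rw [hdH]
    refine d.deriv_H₁_ne_zero (hI hs) ?_
    have := hdX s; rw [hX] at this; linarith
  · -- hco
    intro t ht t' ht' hlt h0 _
    rw [c.cUp_fst_eq hκ hκ' hε hε' hu hu', c.cUp_fst_eq hκ hκ' hε hε' hu hu'] at h0
    have key := d.co_mono (hI ht') (hI ht) (by linarith) h0.symm
    rw [c.cUp_snd_eq_v hκ hκ' hε hε' hu hu', c.cUp_snd_eq_v hκ hκ' hε hε' hu hu']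
    simp only [hH₁]
    rcases key with ⟨h1, h2⟩ | ⟨h1, h2⟩
    · left; exact ⟨by linarith, by linarith⟩
    · right; exact ⟨by linarith, by linarith⟩
  · -- hcoD
    intro s hs hχ' _
    have eχ : (fun t ↦ c.cUp t 0) = fun t ↦ smoothStep d.a d.b (-t) := funext fun t ↦ c.cUp_fst_eq hκ hκ' hε hε' hu hu' t
    have ev : (fun t ↦ c.cUp t 1) = fun t ↦ 1 - d.v (-t) := funext fun t ↦ c.cUp_snd_eq_v hκ hκ' hε hε' hu hu' t
    rw [eχ, deriv_comp_neg, neg_eq_zero] at hχ'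
    rw [ev, hdH, deriv_const_sub, deriv_comp_neg, neg_neg]
    exact d.co_monoD (hI hs) hχ'

end

end BandCore

end Literature.Topology.FourManifolds
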